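import Mathlib
import HarnessLib

/-!
# Route `KLProgramme` — crux C4a, S3 (B4)-(T) — FOLD-WINDOW CALCULUS, part 2 («(B4)-TAN-FOLD», THE C² FOLD: ENERGY INEQUALITY, UNFOLDING COORDINATE,
# LEVEL-SET LAW): `4b(g − g_min) ≤ (g′)²`, `√b·|t − s| ≤ |ψ t − ψ s|` for `ψ = √(g − g_min)`, and
# `vol{φ ∈ [α,β] : g φ ∈ [y₁,y₂]} ≤ 2(√(y₂ − g_min) − √(y₁ − g_min))/√b ≤ 2√((y₂ − y₁)/b)`

Cell `gate-hubbard-kl`, seat hubbard-kl-k3c3-p3 (g21; row «implicit-function / monotonicity route»).  Located brick for the (C)-closer lane c4a-1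
(stub (C) `stub_twoLeg_curvature` of `KLRegimeEngineV17F2`, stmt-HubbardSuperconductivity-20437), C4A-PLAN §24.2 («the square-root (Kohn) anomaly» at the
tangency configuration (T)), §24.4 (power counting near (T)), §24.9.  On a loop-angle window where the partner band `g = ē(e,·;ρ,ϑ,θ)` has the CURVATURE
FLOOR `∂_φ² g ≥ 2b > 0` (at the exact configuration `∂_φ²ē(0) = 2b_T(θ) ≥ (3/100)·u_min²` by `…C4aTangencyCurvatureFloor.curvCoeff_ge_umin_sq_of_frameOK`;
nearby by the order-2 Lipschitz bookkeeping of the lane), `g` has one minimum `c` on the window, is strictly monotone on each side, and the IMPLICIT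
FUNCTION at the fold is the unfolding coordinate `ψ = √(g − g c)` with `|dφ/dψ| ≤ b^{−1/2}`.  Consequences typed here (all [folklore]):

* §1 ONE-SIDED FOLD (`[c, β]`, minimum at the left end): `fold_deriv_pos_right` (`g′ > 0` on `(c, β]`), `fold_strictMonoOn_right`,
  **`fold_energy_right`** `4b(g t − g c) ≤ (g′ t)²`, `fold_deriv_ge_right` `2√b·√(g t − g c) ≤ g′ t`, **`fold_unfolding_right`**
  `√b(t − s) ≤ √(g t − g c) − √(g s − g c)` (`c ≤ s ≤ t ≤ β`), `fold_quadratic_right` `b(t − c)² ≤ g t − g c`, `fold_levelSet_dist_right`;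
* §2 the mirror statements on `[α, c]` (minimum at the right end), by `t ↦ −t` (`fold_reflect_hyps`);
* §3 TWO-SIDED WINDOW `[α, β]` with a minimiser `c` (`exists_fold_min`): **`fold_quadratic`**, `fold_energy`, **`volume_fold_levelSet_le`**
  `vol{φ ∈ [α,β] : g φ ∈ [y₁,y₂]} ≤ 2(√(y₂ − g c) − √(y₁ − g c))/√b` (`√` = `Real.sqrt`, `= 0` below `g c`) and **`volume_fold_levelSet_le_sqrt_sub`**
  `≤ 2√((y₂ − y₁)/b)` — a shell `{|g − y| ≤ ε}` has loop-angle measure `≤ 2√(2ε/b)` uniformly in the level `y`, and `≤ 2(√(ε′+2ε) − √ε′)/√b ≲ 2ε/√(b ε′)` at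
  height `ε′` above the fold value (the transversal regime emerging continuously from the fold).

Carrier-free (`g : ℝ → ℝ`); nothing is asserted about the Hubbard model.  Part 1 is `…C4aFoldWindow` (derivative-free sublevel geometry from the landed
two-sided value); part 3 `…C4aFoldSubstitution` is the integral form.  References: FST II, CPAM 51 (1998) §3 [cite: FeldmanSalmhoferTrubowitz1998];
BGM 2006 §2.4 [cite: BenfattoGiulianiMastropietro2006].
-/

noncomputable section

namespace Summit.HubbardSuperconductivity.HubbardSuperconductivity.Theorems.C4a

set_option linter.dupNamespace false -- summit = problem name (single-conjunct summit), D-0017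

open Real Set Filter MeasureTheory intervalIntegral
open scoped Topology ENNReal

variable {E : Type*} [NormedAddCommGroup E] [NormedSpace ℝ E]

/-! ## §0 Calculus prerequisites for a `C²` function -/

section Prelim

variable {g : ℝ → ℝ}

/-- `g ∈ C²` ⟹ `g′ ∈ C¹`. -/
theorem contDiff_one_deriv_of_two (hg : ContDiff ℝ 2 g) : ContDiff ℝ 1 (deriv g) := by
  have h := hg.iterate_deriv' 1 1
  simpa using h

/-- `g ∈ C²` ⟹ `g′` has derivative `g″ = iteratedDeriv 2 g`. -/
theorem hasDerivAt_deriv_of_two (hg : ContDiff ℝ 2 g) (t : ℝ) : HasDerivAt (deriv g) (iteratedDeriv 2 g t) t := by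
  have h1 : HasDerivAt (deriv g) (deriv (deriv g) t) t :=
    (((contDiff_one_deriv_of_two hg).differentiable one_ne_zero) t).hasDerivAt
  have e : iteratedDeriv 2 g = deriv (deriv g) := by
    rw [show (2 : ℕ) = 1 + 1 from rfl, iteratedDeriv_succ, iteratedDeriv_one]
  rwa [e]

/-- `g ∈ C²` ⟹ `g` has derivative `g′`. -/
theorem hasDerivAt_of_two (hg : ContDiff ℝ 2 g) (t : ℝ) : HasDerivAt g (deriv g t) t :=
  ((hg.differentiable (by norm_num)) t).hasDerivAt

end Prelim

/-! ## §1 One-sided fold: window `[c, β]`, curvature floor `g″ ≥ 2b`, minimum at the left end -/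

section Right

variable {g : ℝ → ℝ} {b c β : ℝ}

/-- `g′` is strictly increasing on a window where `g″ > 0`. -/
theorem fold_strictMonoOn_deriv (hg : ContDiff ℝ 2 g) (hb : 0 < b) (hconv : ∀ t ∈ Icc c β, 2 * b ≤ iteratedDeriv 2 g t) :
    StrictMonoOn (deriv g) (Icc c β) := by
  refine strictMonoOn_of_deriv_pos (convex_Icc c β) (contDiff_one_deriv_of_two hg).continuous.continuousOn fun t ht => ?_
  rw [interior_Icc] at ht
  rw [(hasDerivAt_deriv_of_two hg t).deriv]
  linarith [hconv t (Ioo_subset_Icc_self ht)]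

/-- **NO CRITICAL POINT PAST THE MINIMUM**: minimum at the left end `c` ⟹ `0 < g′ t` for `t ∈ (c, β]` (mean value + monotone slope). [folklore] -/
theorem fold_deriv_pos_right (hg : ContDiff ℝ 2 g) (hb : 0 < b) (hconv : ∀ t ∈ Icc c β, 2 * b ≤ iteratedDeriv 2 g t)
    (hmin : ∀ t ∈ Icc c β, g c ≤ g t) {t : ℝ} (ht : t ∈ Ioc c β) : 0 < deriv g t := by
  obtain ⟨ξ, hξ, hslope⟩ := exists_deriv_eq_slope g ht.1 hg.continuous.continuousOn
    (fun x _ => ((hg.differentiable (by norm_num)) x).differentiableWithinAt)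
  have hξ0 : 0 ≤ deriv g ξ := by
    rw [hslope]; exact div_nonneg (sub_nonneg.2 (hmin t ⟨ht.1.le, ht.2⟩)) (sub_pos.2 ht.1).le
  have hlt : deriv g ξ < deriv g t :=
    fold_strictMonoOn_deriv hg hb hconv ⟨hξ.1.le, hξ.2.le.trans ht.2⟩ ⟨ht.1.le, ht.2⟩ hξ.2
  linarith

/-- `g` is strictly increasing on `[c, β]`. [folklore] -/
theorem fold_strictMonoOn_right (hg : ContDiff ℝ 2 g) (hb : 0 < b) (hconv : ∀ t ∈ Icc c β, 2 * b ≤ iteratedDeriv 2 g t)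
    (hmin : ∀ t ∈ Icc c β, g c ≤ g t) : StrictMonoOn g (Icc c β) := by
  refine strictMonoOn_of_deriv_pos (convex_Icc c β) hg.continuous.continuousOn fun t ht => ?_
  rw [interior_Icc] at ht
  exact fold_deriv_pos_right hg hb hconv hmin ⟨ht.1, ht.2.le⟩

/-- **THE ENERGY INEQUALITY AT A FOLD**: `4b·(g t − g c) ≤ (g′ t)²` on `[c, β]` (the quantity `(g′)² − 4b(g − g c)` is nondecreasing past the minimum). [folklore] -/
theorem fold_energy_right (hg : ContDiff ℝ 2 g) (hb : 0 < b) (hconv : ∀ t ∈ Icc c β, 2 * b ≤ iteratedDeriv 2 g t)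
    (hmin : ∀ t ∈ Icc c β, g c ≤ g t) {t : ℝ} (ht : t ∈ Icc c β) : 4 * b * (g t - g c) ≤ deriv g t ^ 2 := by
  -- `F s := (g′ s)² − 4b(g s − g c)` has `F′ = 2 g′ (g″ − 2b) ≥ 0` on `(c, β)`
  set F : ℝ → ℝ := fun s => deriv g s ^ 2 - 4 * b * (g s - g c) with hF
  have hFd : ∀ s, HasDerivAt F (2 * deriv g s * iteratedDeriv 2 g s - 4 * b * deriv g s) s := by
    intro s
    have h1 := (hasDerivAt_deriv_of_two hg s).pow 2
    have h2 := ((hasDerivAt_of_two hg s).sub_const (g c)).const_mul (4 * b)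
    exact (h1.sub h2).congr_deriv (by norm_num)
  have hmono : MonotoneOn F (Icc c β) := by
    refine monotoneOn_of_deriv_nonneg (convex_Icc c β) (fun s _ => (hFd s).continuousAt.continuousWithinAt)
      (fun s _ => (hFd s).differentiableAt.differentiableWithinAt) fun s hs => ?_
    rw [interior_Icc] at hs
    rw [(hFd s).deriv]
    have hpos := fold_deriv_pos_right hg hb hconv hmin ⟨hs.1, hs.2.le⟩
    have h2 := hconv s (Ioo_subset_Icc_self hs)
    nlinarith
  have h := hmono (left_mem_Icc.2 (ht.1.trans ht.2)) ht ht.1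
  simp only [hF, sub_self, mul_zero, sub_zero] at h
  nlinarith [sq_nonneg (deriv g c)]

/-- `2√b·√(g t − g c) ≤ g′ t` on `(c, β]`. [folklore] -/
theorem fold_deriv_ge_right (hg : ContDiff ℝ 2 g) (hb : 0 < b) (hconv : ∀ t ∈ Icc c β, 2 * b ≤ iteratedDeriv 2 g t)
    (hmin : ∀ t ∈ Icc c β, g c ≤ g t) {t : ℝ} (ht : t ∈ Ioc c β) : 2 * Real.sqrt b * Real.sqrt (g t - g c) ≤ deriv g t := by
  have hE := fold_energy_right hg hb hconv hmin ⟨ht.1.le, ht.2⟩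
  have hpos := fold_deriv_pos_right hg hb hconv hmin ht
  have h1 : 2 * Real.sqrt b * Real.sqrt (g t - g c) = Real.sqrt (4 * b * (g t - g c)) := by
    rw [show 4 * b * (g t - g c) = (2 ^ 2 * b) * (g t - g c) by ring, Real.sqrt_mul (by positivity), Real.sqrt_mul (by positivity),
      Real.sqrt_sq (by norm_num : (0:ℝ) ≤ 2)]
  rw [h1, ← Real.sqrt_sq hpos.le]
  exact Real.sqrt_le_sqrt hE

/-- **THE UNFOLDING COORDINATE** `ψ = √(g − g c)` is expanding at rate `√b`: `√b·(t − s) ≤ ψ t − ψ s` for `c ≤ s ≤ t ≤ β` (the implicit function at the fold: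
`|dφ/dψ| ≤ b^{−1/2}`). [folklore] -/
theorem fold_unfolding_right (hg : ContDiff ℝ 2 g) (hb : 0 < b) (hconv : ∀ t ∈ Icc c β, 2 * b ≤ iteratedDeriv 2 g t)
    (hmin : ∀ t ∈ Icc c β, g c ≤ g t) {s t : ℝ} (hcs : c ≤ s) (hst : s ≤ t) (htβ : t ≤ β) :
    Real.sqrt b * (t - s) ≤ Real.sqrt (g t - g c) - Real.sqrt (g s - g c) := by
  -- `k r := √(g r − g c) − √b·r` is nondecreasing on `[c, β]`
  set k : ℝ → ℝ := fun r => Real.sqrt (g r - g c) - Real.sqrt b * r with hk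
  have hkc : ContinuousOn k (Icc c β) :=
    ((hg.continuous.sub continuous_const).sqrt.sub (continuous_const.mul continuous_id)).continuousOn
  have hkd : ∀ r ∈ Ioo c β, HasDerivAt k (deriv g r / (2 * Real.sqrt (g r - g c)) - Real.sqrt b) r := by
    intro r hr
    have hne : g r - g c ≠ 0 :=
      (sub_pos.2 (fold_strictMonoOn_right hg hb hconv hmin (left_mem_Icc.2 (hr.1.le.trans hr.2.le)) ⟨hr.1.le, hr.2.le⟩ hr.1)).ne'
    have h1 := ((hasDerivAt_of_two hg r).sub_const (g c)).sqrt hne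
    have h2 := (hasDerivAt_id r).const_mul (Real.sqrt b)
    exact (h1.sub h2).congr_deriv (by simp)
  have hmono : MonotoneOn k (Icc c β) := by
    refine monotoneOn_of_deriv_nonneg (convex_Icc c β) hkc (fun r hr => ?_) fun r hr => ?_
    · rw [interior_Icc] at hr; exact (hkd r hr).differentiableAt.differentiableWithinAt
    · rw [interior_Icc] at hr
      rw [(hkd r hr).deriv]
      have hpos : 0 < g r - g c :=
        sub_pos.2 (fold_strictMonoOn_right hg hb hconv hmin (left_mem_Icc.2 (hr.1.le.trans hr.2.le)) ⟨hr.1.le, hr.2.le⟩ hr.1)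
      have hsq : 0 < Real.sqrt (g r - g c) := Real.sqrt_pos.2 hpos
      have hge := fold_deriv_ge_right hg hb hconv hmin ⟨hr.1, hr.2.le⟩
      rw [sub_nonneg, le_div_iff₀ (by positivity)]
      linarith
  have h := hmono ⟨hcs, hst.trans htβ⟩ ⟨hcs.trans hst, htβ⟩ hst
  simp only [hk] at h
  linarith

/-- **QUADRATIC GROWTH PAST THE FOLD**: `b·(t − c)² ≤ g t − g c` on `[c, β]`. [folklore] -/
theorem fold_quadratic_right (hg : ContDiff ℝ 2 g) (hb : 0 < b) (hconv : ∀ t ∈ Icc c β, 2 * b ≤ iteratedDeriv 2 g t)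
    (hmin : ∀ t ∈ Icc c β, g c ≤ g t) {t : ℝ} (ht : t ∈ Icc c β) : b * (t - c) ^ 2 ≤ g t - g c := by
  have h := fold_unfolding_right hg hb hconv hmin le_rfl ht.1 ht.2
  rw [sub_self, Real.sqrt_zero, sub_zero] at h
  have h0 : 0 ≤ Real.sqrt b * (t - c) := mul_nonneg (Real.sqrt_nonneg _) (sub_nonneg.2 ht.1)
  have h2 := pow_le_pow_left₀ h0 h 2
  rw [mul_pow, Real.sq_sqrt hb.le, Real.sq_sqrt (sub_nonneg.2 (hmin t ht))] at h2
  exact h2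

/-- **LEVEL SETS PAST THE FOLD ARE SHORT**: `s, t ∈ [c, β]` with `g s, g t ∈ [y₁, y₂]` ⟹ `|t − s| ≤ (√(y₂ − g c) − √(y₁ − g c))/√b` (`Real.sqrt`, so the
second root vanishes when `y₁ < g c`). [folklore] -/
theorem fold_levelSet_dist_right (hg : ContDiff ℝ 2 g) (hb : 0 < b) (hconv : ∀ t ∈ Icc c β, 2 * b ≤ iteratedDeriv 2 g t)
    (hmin : ∀ t ∈ Icc c β, g c ≤ g t) {y₁ y₂ s t : ℝ} (hs : s ∈ Icc c β) (ht : t ∈ Icc c β)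
    (hgs : g s ∈ Icc y₁ y₂) (hgt : g t ∈ Icc y₁ y₂) :
    |t - s| ≤ (Real.sqrt (y₂ - g c) - Real.sqrt (y₁ - g c)) / Real.sqrt b := by
  have hb' : 0 < Real.sqrt b := Real.sqrt_pos.2 hb
  rw [le_div_iff₀ hb', mul_comm]
  -- reduce to `s ≤ t` by symmetry
  wlog hst : s ≤ t generalizing s t
  · have h := this ht hs hgt hgs (le_of_not_ge hst)
    rwa [abs_sub_comm] at h
  rw [abs_of_nonneg (sub_nonneg.2 hst)]
  refine (fold_unfolding_right hg hb hconv hmin hs.1 hst ht.2).trans ?_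
  have h1 : Real.sqrt (g t - g c) ≤ Real.sqrt (y₂ - g c) := Real.sqrt_le_sqrt (by linarith [hgt.2])
  have h2 : Real.sqrt (y₁ - g c) ≤ Real.sqrt (g s - g c) := Real.sqrt_le_sqrt (by linarith [hgs.1])
  linarith

end Right

/-! ## §2 The mirror: window `[α, c]`, minimum at the right end (by `t ↦ −t`) -/

section Left

variable {g : ℝ → ℝ} {b α c : ℝ}

/-- Reflection bookkeeping: `t ↦ g(−t)` is `C²` with the same second derivative (at `−t`). -/
theorem fold_reflect_hyps (hg : ContDiff ℝ 2 g) (hconv : ∀ t ∈ Icc α c, 2 * b ≤ iteratedDeriv 2 g t) (hmin : ∀ t ∈ Icc α c, g c ≤ g t) :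
    ContDiff ℝ 2 (fun t => g (-t)) ∧ (∀ t ∈ Icc (-c) (-α), 2 * b ≤ iteratedDeriv 2 (fun t => g (-t)) t) ∧
      (∀ t ∈ Icc (-c) (-α), (fun t => g (-t)) (-c) ≤ (fun t => g (-t)) t) := by
  refine ⟨hg.comp contDiff_neg, fun t ht => ?_, fun t ht => ?_⟩
  · rw [iteratedDeriv_comp_neg 2 g t]
    have : ((-1 : ℝ) ^ 2) = 1 := by norm_num
    rw [this, one_smul]
    exact hconv (-t) ⟨by linarith [ht.2], by linarith [ht.1]⟩
  · simp only [neg_neg]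
    exact hmin (-t) ⟨by linarith [ht.2], by linarith [ht.1]⟩

/-- `g′ < 0` on `[α, c)` when the minimum is at the right end. [folklore] -/
theorem fold_deriv_neg_left (hg : ContDiff ℝ 2 g) (hb : 0 < b) (hconv : ∀ t ∈ Icc α c, 2 * b ≤ iteratedDeriv 2 g t)
    (hmin : ∀ t ∈ Icc α c, g c ≤ g t) {t : ℝ} (ht : t ∈ Ico α c) : deriv g t < 0 := by
  obtain ⟨h1, h2, h3⟩ := fold_reflect_hyps hg hconv hmin
  have h := fold_deriv_pos_right h1 hb h2 h3 (t := -t) ⟨by linarith [ht.2], by linarith [ht.1]⟩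
  rw [deriv_comp_neg, neg_neg] at h
  linarith

/-- Energy inequality on `[α, c]`: `4b(g t − g c) ≤ (g′ t)²`. [folklore] -/
theorem fold_energy_left (hg : ContDiff ℝ 2 g) (hb : 0 < b) (hconv : ∀ t ∈ Icc α c, 2 * b ≤ iteratedDeriv 2 g t)
    (hmin : ∀ t ∈ Icc α c, g c ≤ g t) {t : ℝ} (ht : t ∈ Icc α c) : 4 * b * (g t - g c) ≤ deriv g t ^ 2 := by
  obtain ⟨h1, h2, h3⟩ := fold_reflect_hyps hg hconv hmin
  have h := fold_energy_right h1 hb h2 h3 (t := -t) ⟨by linarith [ht.2], by linarith [ht.1]⟩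
  simp only [deriv_comp_neg, neg_neg, neg_sq] at h
  exact h

/-- Unfolding coordinate on `[α, c]`: `√b·(t − s) ≤ √(g s − g c) − √(g t − g c)` for `α ≤ s ≤ t ≤ c`. [folklore] -/
theorem fold_unfolding_left (hg : ContDiff ℝ 2 g) (hb : 0 < b) (hconv : ∀ t ∈ Icc α c, 2 * b ≤ iteratedDeriv 2 g t)
    (hmin : ∀ t ∈ Icc α c, g c ≤ g t) {s t : ℝ} (hαs : α ≤ s) (hst : s ≤ t) (htc : t ≤ c) :
    Real.sqrt b * (t - s) ≤ Real.sqrt (g s - g c) - Real.sqrt (g t - g c) := by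
  obtain ⟨h1, h2, h3⟩ := fold_reflect_hyps hg hconv hmin
  have h := fold_unfolding_right h1 hb h2 h3 (s := -t) (t := -s) (by linarith) (by linarith) (by linarith)
  simp only [neg_neg] at h
  linarith

/-- Quadratic growth on `[α, c]`: `b·(t − c)² ≤ g t − g c`. [folklore] -/
theorem fold_quadratic_left (hg : ContDiff ℝ 2 g) (hb : 0 < b) (hconv : ∀ t ∈ Icc α c, 2 * b ≤ iteratedDeriv 2 g t)
    (hmin : ∀ t ∈ Icc α c, g c ≤ g t) {t : ℝ} (ht : t ∈ Icc α c) : b * (t - c) ^ 2 ≤ g t - g c := by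
  obtain ⟨h1, h2, h3⟩ := fold_reflect_hyps hg hconv hmin
  have h := fold_quadratic_right h1 hb h2 h3 (t := -t) ⟨by linarith [ht.2], by linarith [ht.1]⟩
  simp only [neg_neg] at h
  calc b * (t - c) ^ 2 = b * (-t - -c) ^ 2 := by ring
    _ ≤ g t - g c := h

/-- Level sets on `[α, c]` are short. [folklore] -/
theorem fold_levelSet_dist_left (hg : ContDiff ℝ 2 g) (hb : 0 < b) (hconv : ∀ t ∈ Icc α c, 2 * b ≤ iteratedDeriv 2 g t)
    (hmin : ∀ t ∈ Icc α c, g c ≤ g t) {y₁ y₂ s t : ℝ} (hs : s ∈ Icc α c) (ht : t ∈ Icc α c)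
    (hgs : g s ∈ Icc y₁ y₂) (hgt : g t ∈ Icc y₁ y₂) :
    |t - s| ≤ (Real.sqrt (y₂ - g c) - Real.sqrt (y₁ - g c)) / Real.sqrt b := by
  obtain ⟨h1, h2, h3⟩ := fold_reflect_hyps hg hconv hmin
  have h := fold_levelSet_dist_right h1 hb h2 h3 (y₁ := y₁) (y₂ := y₂) (s := -s) (t := -t)
    ⟨by linarith [hs.2], by linarith [hs.1]⟩ ⟨by linarith [ht.2], by linarith [ht.1]⟩ (by simpa using hgs) (by simpa using hgt)
  simp only [neg_neg] at h
  rwa [show -t - -s = -(t - s) by ring, abs_neg] at h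

end Left

/-! ## §3 Two-sided window `[α, β]` with a minimiser `c` -/

section TwoSided

variable {g : ℝ → ℝ} {b α β c : ℝ}

/-- A continuous function attains its minimum on the window (packaging of `IsCompact.exists_isMinOn`). -/
theorem exists_fold_min (hg : Continuous g) (hαβ : α ≤ β) : ∃ c ∈ Icc α β, ∀ t ∈ Icc α β, g c ≤ g t := by
  obtain ⟨c, hc, hmin⟩ := isCompact_Icc.exists_isMinOn (nonempty_Icc.2 hαβ) hg.continuousOn
  exact ⟨c, hc, fun t ht => hmin ht⟩

/-- **QUADRATIC GROWTH AROUND THE FOLD**: `b·(t − c)² ≤ g t − g c` on the whole window. [folklore] -/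
theorem fold_quadratic (hg : ContDiff ℝ 2 g) (hb : 0 < b) (hconv : ∀ t ∈ Icc α β, 2 * b ≤ iteratedDeriv 2 g t)
    (hc : c ∈ Icc α β) (hmin : ∀ t ∈ Icc α β, g c ≤ g t) {t : ℝ} (ht : t ∈ Icc α β) : b * (t - c) ^ 2 ≤ g t - g c := by
  rcases le_total c t with hct | htc
  · exact fold_quadratic_right hg hb (fun s hs => hconv s ⟨hc.1.trans hs.1, hs.2⟩) (fun s hs => hmin s ⟨hc.1.trans hs.1, hs.2⟩) ⟨hct, ht.2⟩
  · exact fold_quadratic_left hg hb (fun s hs => hconv s ⟨hs.1, hs.2.trans hc.2⟩) (fun s hs => hmin s ⟨hs.1, hs.2.trans hc.2⟩) ⟨ht.1, htc⟩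

/-- Energy inequality on the whole window. [folklore] -/
theorem fold_energy (hg : ContDiff ℝ 2 g) (hb : 0 < b) (hconv : ∀ t ∈ Icc α β, 2 * b ≤ iteratedDeriv 2 g t)
    (hc : c ∈ Icc α β) (hmin : ∀ t ∈ Icc α β, g c ≤ g t) {t : ℝ} (ht : t ∈ Icc α β) : 4 * b * (g t - g c) ≤ deriv g t ^ 2 := by
  rcases le_total c t with hct | htc
  · exact fold_energy_right hg hb (fun s hs => hconv s ⟨hc.1.trans hs.1, hs.2⟩) (fun s hs => hmin s ⟨hc.1.trans hs.1, hs.2⟩) ⟨hct, ht.2⟩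
  · exact fold_energy_left hg hb (fun s hs => hconv s ⟨hs.1, hs.2.trans hc.2⟩) (fun s hs => hmin s ⟨hs.1, hs.2.trans hc.2⟩) ⟨ht.1, htc⟩

/-- **THE LEVEL-SET LAW AT A FOLD**: `vol {φ ∈ [α,β] : g φ ∈ [y₁,y₂]} ≤ 2·(√(y₂ − g c) − √(y₁ − g c))/√b`. [folklore] -/
theorem volume_fold_levelSet_le (hg : ContDiff ℝ 2 g) (hb : 0 < b) (hconv : ∀ t ∈ Icc α β, 2 * b ≤ iteratedDeriv 2 g t)
    (hc : c ∈ Icc α β) (hmin : ∀ t ∈ Icc α β, g c ≤ g t) (y₁ y₂ : ℝ) :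
    volume {φ : ℝ | φ ∈ Icc α β ∧ g φ ∈ Icc y₁ y₂} ≤
      ENNReal.ofReal (2 * ((Real.sqrt (y₂ - g c) - Real.sqrt (y₁ - g c)) / Real.sqrt b)) := by
  set D := (Real.sqrt (y₂ - g c) - Real.sqrt (y₁ - g c)) / Real.sqrt b with hD
  set Sl := {φ : ℝ | φ ∈ Icc α c ∧ g φ ∈ Icc y₁ y₂} with hSl
  set Sr := {φ : ℝ | φ ∈ Icc c β ∧ g φ ∈ Icc y₁ y₂} with hSr
  have hsub : {φ : ℝ | φ ∈ Icc α β ∧ g φ ∈ Icc y₁ y₂} ⊆ Sl ∪ Sr := by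
    intro φ hφ
    rcases le_total φ c with h | h
    · exact Or.inl ⟨⟨hφ.1.1, h⟩, hφ.2⟩
    · exact Or.inr ⟨⟨h, hφ.1.2⟩, hφ.2⟩
  have hl : volume Sl ≤ ENNReal.ofReal D := by
    refine (Real.volume_le_diam Sl).trans (Metric.ediam_le fun s hs t ht => ?_)
    rw [edist_dist, Real.dist_eq, abs_sub_comm]
    exact ENNReal.ofReal_le_ofReal (fold_levelSet_dist_left hg hb (fun r hr => hconv r ⟨hr.1, hr.2.trans hc.2⟩)
      (fun r hr => hmin r ⟨hr.1, hr.2.trans hc.2⟩) hs.1 ht.1 hs.2 ht.2)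
  have hr : volume Sr ≤ ENNReal.ofReal D := by
    refine (Real.volume_le_diam Sr).trans (Metric.ediam_le fun s hs t ht => ?_)
    rw [edist_dist, Real.dist_eq, abs_sub_comm]
    exact ENNReal.ofReal_le_ofReal (fold_levelSet_dist_right hg hb (fun r hr => hconv r ⟨hc.1.trans hr.1, hr.2⟩)
      (fun r hr => hmin r ⟨hc.1.trans hr.1, hr.2⟩) hs.1 ht.1 hs.2 ht.2)
  calc volume {φ : ℝ | φ ∈ Icc α β ∧ g φ ∈ Icc y₁ y₂} ≤ volume (Sl ∪ Sr) := measure_mono hsub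
    _ ≤ volume Sl + volume Sr := measure_union_le _ _
    _ ≤ ENNReal.ofReal D + ENNReal.ofReal D := add_le_add hl hr
    _ = ENNReal.ofReal (2 * D) := by
        rcases le_or_gt 0 D with hD0 | hD0
        · rw [two_mul, ENNReal.ofReal_add hD0 hD0]
        · rw [ENNReal.ofReal_of_nonpos hD0.le, ENNReal.ofReal_of_nonpos (by linarith), add_zero]

/-- `√p − √q ≤ √(p − q)` for `q ≤ p` (`Real.sqrt`, so meaningful for all signs). -/
theorem sqrt_sub_sqrt_le_sqrt_sub {p q : ℝ} (hqp : q ≤ p) : Real.sqrt p - Real.sqrt q ≤ Real.sqrt (p - q) := by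
  rcases le_or_gt 0 q with hq | hq
  · have hpq : 0 ≤ p - q := sub_nonneg.2 hqp
    have hp : 0 ≤ p := hq.trans hqp
    have h1 : Real.sqrt p ≤ Real.sqrt (p - q) + Real.sqrt q := by
      rw [Real.sqrt_le_left (by positivity)]
      nlinarith [Real.sq_sqrt hpq, Real.sq_sqrt hq, mul_nonneg (Real.sqrt_nonneg (p - q)) (Real.sqrt_nonneg q)]
    linarith
  · rw [Real.sqrt_eq_zero'.2 hq.le, sub_zero]
    exact Real.sqrt_le_sqrt (by linarith)

/-- **THE LEVEL-SET LAW, UNIFORM FORM**: for `y₁ ≤ y₂`, `vol {φ ∈ [α,β] : g φ ∈ [y₁,y₂]} ≤ 2·√((y₂ − y₁)/b)` — a shell of level-width `2ε` has loop-angle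
measure `≤ 2√(2ε/b)` wherever it sits relative to the fold value (the square-root law). [folklore] -/
theorem volume_fold_levelSet_le_sqrt_sub (hg : ContDiff ℝ 2 g) (hb : 0 < b) (hconv : ∀ t ∈ Icc α β, 2 * b ≤ iteratedDeriv 2 g t)
    (hc : c ∈ Icc α β) (hmin : ∀ t ∈ Icc α β, g c ≤ g t) {y₁ y₂ : ℝ} (hy : y₁ ≤ y₂) :
    volume {φ : ℝ | φ ∈ Icc α β ∧ g φ ∈ Icc y₁ y₂} ≤ ENNReal.ofReal (2 * Real.sqrt ((y₂ - y₁) / b)) := by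
  refine (volume_fold_levelSet_le hg hb hconv hc hmin y₁ y₂).trans (ENNReal.ofReal_le_ofReal ?_)
  refine mul_le_mul_of_nonneg_left ?_ (by norm_num)
  rw [Real.sqrt_div (sub_nonneg.2 hy), div_le_div_iff_of_pos_right (Real.sqrt_pos.2 hb)]
  have h := sqrt_sub_sqrt_le_sqrt_sub (p := y₂ - g c) (q := y₁ - g c) (by linarith)
  rwa [show y₂ - g c - (y₁ - g c) = y₂ - y₁ by ring] at h

end TwoSided

end Summit.HubbardSuperconductivity.HubbardSuperconductivity.Theorems.C4a

end
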